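import Literature.RepresentationTheory.FiniteGroups.BrauerInduction
import HarnessLib

/-!
# Induced class functions: Frobenius reciprocity and the projection formula

Topic `Literature/RepresentationTheory/FiniteGroups`; continues
`Literature.RepresentationTheory.FiniteGroups.BrauerInduction` (`indClassFun H φ`, the class
function on `G` induced by `φ : H → ℂ`, Serre, *Linear Representations of Finite Groups*,
§7.2).  This file proves the two formal properties of induction on class functions that drive
the ring-theoretic part of the proof of Brauer's theorem (Serre §10.2: "`V_p` is an ideal of
`R(G)`", via (ii) below, and the Frobenius-reciprocity bookkeeping of §7.2):

* `classInner φ ψ = ⟨φ, ψ⟩ = (1/|G|) ∑_{s ∈ G} φ(s) ψ(s⁻¹)` — the bilinear form of Serre §7.2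
  (same normalisation as Mathlib's `Representation.char_orthonormal`);
* `IsClassFun φ` — `φ (t s t⁻¹) = φ s`;
* **Frobenius reciprocity** (Serre §7.2, Thm. 13; Neukirch VII (10.2)):
  `⟨Ind_H^G ψ, φ⟩_G = ⟨ψ, Res_H φ⟩_H` for every function `ψ` on `H` and every class function
  `φ` on `G` (`classInner_indClassFun_left`);
* **the projection formula** (Serre §7.2, Remark (3): `Ind_H^G(ψ · Res φ) = (Ind_H^G ψ) · φ`)
  for a class function `φ` on `G` (`indClassFun_mul_restrict`).

All proofs are finite-sum manipulations (reindexing by conjugation, summing an extension by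
zero over `G`).

## Mathlib search

Mathlib (this pin) has `Representation.character`, `char_conj`, the scalar product inside
`char_orthonormal` (not as a named definition), `Representation.ind`/`coind` with the
categorical Frobenius adjunctions `Rep.indResAdjunction`, `resCoindAdjunction`, but no class
functions on a finite group as such, no Frobenius reciprocity for the scalar product of class
functions and no projection formula (grep `ClassFun`, `reciprocity` in `RepresentationTheory`:
nothing).  Nothing here duplicates a Mathlib declaration.

## References

* J.-P. Serre, *Linear Representations of Finite Groups*, GTM 42 (1977), §7.2 (induced class
  functions, Thm. 13 Frobenius reciprocity, Remark (3)), §10.2 (`SerreLinearRepresentations1977`).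
* J. Neukirch, *Algebraic Number Theory* (1999), VII (10.2) (`NeukirchANT1999`).
-/

noncomputable section

open scoped BigOperators

namespace Literature.RepresentationTheory.FiniteGroups

variable {G : Type} [Group G]

/-! ### Class functions and the scalar product -/

/-- `φ : G → ℂ` **is a class function**: it is constant on conjugacy classes,
`φ (t s t⁻¹) = φ s` (Serre, *Linear Representations*, §2.1, §2.5). [cite: SerreLinearRepresentations1977, §2.5] -/
def IsClassFun (φ : G → ℂ) : Prop :=
  ∀ s t : G, φ (t * s * t⁻¹) = φ s

/-- Characters are class functions (Mathlib `Representation.char_conj`). [folklore] -/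
theorem IsCharacter.isClassFun {χ : G → ℂ} (h : IsCharacter G χ) : IsClassFun χ := by
  obtain ⟨V, _, _, _, ρ, rfl⟩ := h
  intro s t
  exact ρ.char_conj s t

/-- Induced functions are class functions (`indClassFun_conj`). [cite: SerreLinearRepresentations1977, §7.2] -/
theorem isClassFun_indClassFun [Fintype G] (H : Subgroup G) (ψ : H → ℂ) :
    IsClassFun (indClassFun H ψ) :=
  fun s t => indClassFun_conj H ψ t s

/-- A class function is invariant under `s ↦ t⁻¹ s t` as well. [folklore] -/
theorem IsClassFun.apply_inv_mul_mul {φ : G → ℂ} (h : IsClassFun φ) (s t : G) :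
    φ (t⁻¹ * s * t) = φ s := by
  simpa using h s t⁻¹

variable [Fintype G]

/-- The **scalar product of class functions** `⟨φ, ψ⟩ = (1/|G|) ∑_{s ∈ G} φ(s) ψ(s⁻¹)`
(Serre, *Linear Representations*, §7.2; for characters this is the hermitian product of §2.3,
and it is the normalisation of Mathlib's `Representation.char_orthonormal`).
[cite: SerreLinearRepresentations1977, §7.2] -/
def classInner (φ ψ : G → ℂ) : ℂ :=
  (Fintype.card G : ℂ)⁻¹ * ∑ s : G, φ s * ψ s⁻¹

/-- Unfolding lemma for `classInner`. [folklore] -/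
theorem classInner_apply (φ ψ : G → ℂ) :
    classInner φ ψ = (Fintype.card G : ℂ)⁻¹ * ∑ s : G, φ s * ψ s⁻¹ := rfl

/-- The scalar product is symmetric: `⟨φ, ψ⟩ = ⟨ψ, φ⟩` (reindex by `s ↦ s⁻¹`).
[cite: SerreLinearRepresentations1977, §7.2] -/
theorem classInner_comm (φ ψ : G → ℂ) : classInner φ ψ = classInner ψ φ := by
  simp only [classInner_apply]
  congr 1
  refine Fintype.sum_equiv (Equiv.inv G) _ _ fun s => ?_
  simp [mul_comm]

/-- The scalar product is additive in the first variable. [folklore] -/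
theorem classInner_add_left (φ φ' ψ : G → ℂ) :
    classInner (φ + φ') ψ = classInner φ ψ + classInner φ' ψ := by
  simp only [classInner_apply, Pi.add_apply, add_mul, Finset.sum_add_distrib, mul_add]

/-- The scalar product is homogeneous in the first variable. [folklore] -/
theorem classInner_smul_left (c : ℂ) (φ ψ : G → ℂ) :
    classInner (c • φ) ψ = c * classInner φ ψ := by
  simp only [classInner_apply, Pi.smul_apply, smul_eq_mul, mul_assoc, ← Finset.mul_sum]
  ring

/-! ### Summing an extension by zero -/

/-- Summing the extension by zero of `ψ : H → ℂ` against any `f` over `G` is summing over `H`.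
[folklore] -/
theorem sum_extend_subtypeVal_mul (H : Subgroup G) [Fintype H] (ψ : H → ℂ) (f : G → ℂ) :
    ∑ u : G, Function.extend (Subtype.val : H → G) ψ 0 u * f u = ∑ x : H, ψ x * f x := by
  classical
  rw [← Finset.sum_subset (Finset.subset_univ ((Finset.univ : Finset H).map
    (Function.Embedding.subtype _)))]
  · rw [Finset.sum_map]
    refine Finset.sum_congr rfl fun x _ => ?_
    simp only [Function.Embedding.coe_subtype]
    rw [extend_subtypeVal_apply]
  · intro u _ hu
    have hu' : u ∉ H := by
      intro h
      exact hu (Finset.mem_map.mpr ⟨⟨u, h⟩, Finset.mem_univ _, rfl⟩)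
    rw [extend_subtypeVal_of_not_mem H ψ hu', zero_mul]

/-- Reindexing the inner sum of Frobenius reciprocity by conjugation: for a class function `φ`,
`∑_s ψ̃(t⁻¹ s t) φ(s⁻¹) = ∑_u ψ̃(u) φ(u⁻¹)` (substitute `s = t u t⁻¹`). [folklore] -/
theorem sum_conj_mul_apply_inv (E : G → ℂ) {φ : G → ℂ} (hφ : IsClassFun φ) (t : G) :
    ∑ s : G, E (t⁻¹ * s * t) * φ s⁻¹ = ∑ u : G, E u * φ u⁻¹ := by
  refine (Fintype.sum_bijective (fun u => t * u * t⁻¹) (MulAut.conj t).bijective _ _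
    fun u => ?_).symm
  have h1 : t⁻¹ * (t * u * t⁻¹) * t = u := by group
  have h2 : (t * u * t⁻¹)⁻¹ = t * u⁻¹ * t⁻¹ := by group
  simp only [h1, h2, hφ u⁻¹ t]

/-! ### Frobenius reciprocity -/

/-- **Frobenius reciprocity** (Serre, *Linear Representations of Finite Groups*, §7.2,
Thm. 13: "`⟨ψ, Res φ⟩_H = ⟨Ind ψ, φ⟩_G`"; Neukirch, *Algebraic Number Theory*, VII (10.2)).
For a subgroup `H` of the finite group `G`, any function `ψ : H → ℂ` and any *class function*
`φ` on `G`: `⟨Ind_H^G ψ, φ⟩_G = ⟨ψ, φ|_H⟩_H` (`indClassFun`, `classInner`).  Proof as printed: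
expand `Ind ψ (s) = (1/h) ∑_t ψ(t⁻¹ s t)`, exchange the sums and substitute `u = t⁻¹ s t`, using
`φ(s⁻¹) = φ(u⁻¹)`. [cite: SerreLinearRepresentations1977, §7.2 Thm. 13]
[cite: NeukirchANT1999, VII (10.2)] -/
theorem classInner_indClassFun_left (H : Subgroup G) [Fintype H] (ψ : H → ℂ) {φ : G → ℂ}
    (hφ : IsClassFun φ) :
    classInner (indClassFun H ψ) φ = classInner ψ (fun x : H => φ x) := by
  simp only [classInner_apply, indClassFun_apply]
  have hcard : (Nat.card H : ℂ) = Fintype.card H := by rw [Nat.card_eq_fintype_card]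
  have hG : (Fintype.card G : ℂ) ≠ 0 := Nat.cast_ne_zero.mpr Fintype.card_ne_zero
  -- each summand: `((1/h) ∑_t ψ̃(t⁻¹st)) φ(s⁻¹) = (1/h) ∑_t ψ̃(t⁻¹st) φ(s⁻¹)`
  have key : ∀ s : G,
      ((Nat.card H : ℂ)⁻¹ * ∑ t : G, Function.extend (Subtype.val : H → G) ψ 0 (t⁻¹ * s * t)) *
        φ s⁻¹ =
      (Nat.card H : ℂ)⁻¹ * ∑ t : G, Function.extend (Subtype.val : H → G) ψ 0 (t⁻¹ * s * t) *
        φ s⁻¹ := fun s => by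
    rw [mul_assoc, Finset.sum_mul]
  rw [Finset.sum_congr rfl fun s _ => key s, ← Finset.mul_sum, Finset.sum_comm]
  -- substitute in each inner sum and collect `|G|` equal terms
  rw [Finset.sum_congr rfl fun t _ => sum_conj_mul_apply_inv _ hφ t, Finset.sum_const,
    Finset.card_univ, nsmul_eq_mul, sum_extend_subtypeVal_mul, hcard]
  field_simp
  simp only [Subgroup.coe_inv]

/-- Frobenius reciprocity with the induced function on the right:
`⟨φ, Ind_H^G ψ⟩_G = ⟨φ|_H, ψ⟩_H`. [cite: SerreLinearRepresentations1977, §7.2 Thm. 13] -/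
theorem classInner_indClassFun_right (H : Subgroup G) [Fintype H] (ψ : H → ℂ) {φ : G → ℂ}
    (hφ : IsClassFun φ) :
    classInner φ (indClassFun H ψ) = classInner (fun x : H => φ x) ψ := by
  rw [classInner_comm, classInner_indClassFun_left H ψ hφ, classInner_comm]

/-! ### The projection formula -/

/-- **The projection formula** `Ind_H^G (ψ · Res_H φ) = (Ind_H^G ψ) · φ` for a class function
`φ` on `G` (Serre, *Linear Representations of Finite Groups*, §7.2, Remark (3); it is what
makes the image of induction an ideal of `R(G)`, §10.2).  Pointwise:
`(1/h) ∑_t ψ(t⁻¹st) φ(t⁻¹st) = ((1/h) ∑_t ψ(t⁻¹st)) φ(s)`.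
[cite: SerreLinearRepresentations1977, §7.2 Remark (3)] -/
theorem indClassFun_mul_restrict (H : Subgroup G) (ψ : H → ℂ) {φ : G → ℂ} (hφ : IsClassFun φ) :
    indClassFun H (fun x : H => ψ x * φ x) = indClassFun H ψ * φ := by
  funext s
  simp only [Pi.mul_apply, indClassFun_apply]
  rw [mul_assoc, Finset.sum_mul]
  congr 1
  refine Finset.sum_congr rfl fun t _ => ?_
  by_cases h : t⁻¹ * s * t ∈ H
  · rw [show t⁻¹ * s * t = ((⟨t⁻¹ * s * t, h⟩ : H) : G) from rfl, extend_subtypeVal_apply,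
      extend_subtypeVal_apply]
    show ψ ⟨t⁻¹ * s * t, h⟩ * φ (t⁻¹ * s * t) = ψ ⟨t⁻¹ * s * t, h⟩ * φ s
    rw [hφ.apply_inv_mul_mul s t]
  · rw [extend_subtypeVal_of_not_mem H _ h, extend_subtypeVal_of_not_mem H _ h, zero_mul]

/-- In particular `Ind_H^G (Res_H φ) = (Ind_H^G 1) · φ`: inducing a restricted class function
multiplies by the permutation character `Ind_H^G 1`. [cite: SerreLinearRepresentations1977, §7.2 Remark (3)] -/
theorem indClassFun_restrict (H : Subgroup G) {φ : G → ℂ} (hφ : IsClassFun φ) :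
    indClassFun H (fun x : H => φ x) = indClassFun H (fun _ => 1) * φ := by
  rw [← indClassFun_mul_restrict H _ hφ]
  simp only [one_mul]

end Literature.RepresentationTheory.FiniteGroups

end
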